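import Summits.BirchSwinnertonDyer.BirchSwinnertonDyer.Theorems.ManinLocalTwoThreeManinPrimeToThreeAtNineKatoShiftLever

/-!
# Route `ManinLocalTwoThree`, crux C3 `ManinPrimeToThreeAtNine` (stmt-BirchSwinnertonDyer-22968): RESIDUAL SYNTHESIS, GENERIC
# AND ON THE TWIST-ORBIT-MINIMAL CLASSES — the shift-twist certificate need only hold, and the reducible residual need only be
# supplied, on whatever class predicate the untwisting reductions reach (line prover p1, lead integration step; helper)

Sequel to `…ManinPrimeToThreeAtNineResidualSynthesis` (p589041, globally twist-minimal classes). Two things: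
* GENERIC SPLIT `maninPrimeToThreeAtNine_of_reduction_of_split`: for ANY predicate `P W N` such that C3 follows from Manin
  at `3` on the lattice-optimal data with `9 ∣ N` and `P W N` (a landed REDUCTION, `hred`), C3 follows from (the
  shift-twist certificate on the `W[3]`-irreducible such data) ∧ (Manin at `3` on the `W[3]`-reducible such data);
  corollaries `…_of_reduction_of_katoShift` (certificate := the leaf `KatoShiftTwistManinThree`, E-es-18) and
  `…_of_reduction_of_katoFact_of_generation` (certificate := F-es-18 ∧ E-es-19 through the landed
  `katoShiftTwistManinThree_of_katoFact_of_generation`).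
* The INSTANCE `P :=` TWIST-ORBIT-MINIMAL (seat p2 gen 2, `maninLocalTwoThree_maninPrimeToThreeAtNine_of_twistOrbitMinimal`,
  p591108; residue 92 797 of 657 019, reducible 7 525) is seat p2's `…TwistOrbitMinimalResidualSynthesis`
  (`maninLocalTwoThree_maninPrimeToThreeAtNine_of_katoFact_of_generation_of_orbitMinimalReducible` etc., landed first) —
  the composition of the lead's v4 skeleton `Lines/kato_shift_three.lean`; this file keeps only the generic split, into
  which any future sharper reduction plugs with no new proof.
`W[3]` is twist-invariant, so restricting the reducible residual leaf to the orbit-minimal classes loses nothing.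
HONEST FRAMING: `proof.conditional` reductions; F-es-18 is a statement-only fact, E-es-19 a conjecture, the residual
open. Manin's conjecture at `3` is NOT proved here; nothing about BSD is proved here.
-/

set_option autoImplicit false
set_option linter.dupNamespace false

noncomputable section

open scoped Classical MatrixGroups ModularForm

open CongruenceSubgroup WeierstrassCurve Literature.NumberTheory.EllipticCurves
  Literature.NumberTheory.EllipticCurves.ModularForms
  Summit.BirchSwinnertonDyer.Rank1Residual.ManinAdditive

namespace Summit.BirchSwinnertonDyer.BirchSwinnertonDyer.Theorems.ManinLocalTwoThree

section Generic

variable (P : WeierstrassCurve ℚ → ℕ → Prop)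

/-- **Generic split of C3 along a reduction**: if C3 follows from Manin at `3` on the lattice-optimal data with `9 ∣ N`
in a class predicate `P` (`hred`), then C3 follows from the shift-twist certificate on the `W[3]`-irreducible such data
and Manin at `3` on the `W[3]`-reducible such data. [cite: Kato2004Asterisque, Thm. 9.7 (p. 189)]
[cite: Stevens1989, Lemmas (5.2), (5.4)] -/
theorem maninPrimeToThreeAtNine_of_reduction_of_split
    (hred : (Literature.NumberTheory.EllipticCurves.ModularForms.mazur_not_dvd_maninConstant_of_odd →
      Literature.NumberTheory.EllipticCurves.ModularForms.abbesUllmo_not_dvd_maninConstant_of_not_dvd_level →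
      Literature.NumberTheory.EllipticCurves.ModularForms.cesnavicius_not_two_dvd_maninConstant_of_two_dvd_level →
      Literature.NumberTheory.EllipticCurves.ModularForms.exists_isNewformOf →
      ∀ (W : WeierstrassCurve ℚ) [W.IsElliptic] [W.IsGloballyMinimal] {N : ℕ} [NeZero N]
        (D : ModularParametrizationData W N),
        (∀ z ∈ D.L.lattice, ∃ w ∈ periodLattice D.f, z = D.c * w) → 3 ^ 2 ∣ N → P W N →
        ¬ (3 : ℤ) ∣ D.maninConstant) →
      Summit.BirchSwinnertonDyer.BirchSwinnertonDyer.Theses.ManinLocalTwoThree.ManinPrimeToThreeAtNine)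
    (hA : ∀ (W : WeierstrassCurve ℚ) [W.IsElliptic] [W.IsGloballyMinimal] {N : ℕ} [NeZero N]
      (D : ModularParametrizationData W N),
      (∀ z ∈ D.L.lattice, ∃ w ∈ periodLattice D.f, z = D.c * w) → 3 ^ 2 ∣ N →
      P W N → W.HasIrreducibleModPGaloisRep 3 → ¬ (3 : ℤ) ∣ D.c)
    (hB : ∀ (W : WeierstrassCurve ℚ) [W.IsElliptic] [W.IsGloballyMinimal] {N : ℕ} [NeZero N]
      (D : ModularParametrizationData W N),
      (∀ z ∈ D.L.lattice, ∃ w ∈ periodLattice D.f, z = D.c * w) → 3 ^ 2 ∣ N →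
      P W N → ¬ W.HasIrreducibleModPGaloisRep 3 → ¬ (3 : ℤ) ∣ D.c)
    : Summit.BirchSwinnertonDyer.BirchSwinnertonDyer.Theses.ManinLocalTwoThree.ManinPrimeToThreeAtNine :=
  hred (fun _hM _hAU _hC _hnf W _ _ N _ D hopt h9 hP => by
    show ¬ (3 : ℤ) ∣ D.c
    by_cases hirr : W.HasIrreducibleModPGaloisRep 3
    · exact hA W D hopt h9 hP hirr
    · exact hB W D hopt h9 hP hirr)

/-- **Generic split, certificate := E-es-18 `KatoShiftTwistManinThree`** (the leaf, unrestricted).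
[cite: Kato2004Asterisque, Thm. 9.7 (p. 189)] -/
theorem maninPrimeToThreeAtNine_of_reduction_of_katoShift
    (hred : (Literature.NumberTheory.EllipticCurves.ModularForms.mazur_not_dvd_maninConstant_of_odd →
      Literature.NumberTheory.EllipticCurves.ModularForms.abbesUllmo_not_dvd_maninConstant_of_not_dvd_level →
      Literature.NumberTheory.EllipticCurves.ModularForms.cesnavicius_not_two_dvd_maninConstant_of_two_dvd_level →
      Literature.NumberTheory.EllipticCurves.ModularForms.exists_isNewformOf →
      ∀ (W : WeierstrassCurve ℚ) [W.IsElliptic] [W.IsGloballyMinimal] {N : ℕ} [NeZero N]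
        (D : ModularParametrizationData W N),
        (∀ z ∈ D.L.lattice, ∃ w ∈ periodLattice D.f, z = D.c * w) → 3 ^ 2 ∣ N → P W N →
        ¬ (3 : ℤ) ∣ D.maninConstant) →
      Summit.BirchSwinnertonDyer.BirchSwinnertonDyer.Theses.ManinLocalTwoThree.ManinPrimeToThreeAtNine)
    (hK3 : KatoShiftTwistManinThree)
    (hB : ∀ (W : WeierstrassCurve ℚ) [W.IsElliptic] [W.IsGloballyMinimal] {N : ℕ} [NeZero N]
      (D : ModularParametrizationData W N),
      (∀ z ∈ D.L.lattice, ∃ w ∈ periodLattice D.f, z = D.c * w) → 3 ^ 2 ∣ N →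
      P W N → ¬ W.HasIrreducibleModPGaloisRep 3 → ¬ (3 : ℤ) ∣ D.c)
    : Summit.BirchSwinnertonDyer.BirchSwinnertonDyer.Theses.ManinLocalTwoThree.ManinPrimeToThreeAtNine :=
  maninPrimeToThreeAtNine_of_reduction_of_split P hred (fun W _ _ _ _ D hopt h9 _ hirr => hK3 W D hopt h9 hirr) hB

/-- **Generic split, certificate := F-es-18 ∧ E-es-19** (through the landed
`katoShiftTwistManinThree_of_katoFact_of_generation`). [cite: Kato2004Asterisque, Thm. 9.7 (p. 189)] -/
theorem maninPrimeToThreeAtNine_of_reduction_of_katoFact_of_generation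
    (hred : (Literature.NumberTheory.EllipticCurves.ModularForms.mazur_not_dvd_maninConstant_of_odd →
      Literature.NumberTheory.EllipticCurves.ModularForms.abbesUllmo_not_dvd_maninConstant_of_not_dvd_level →
      Literature.NumberTheory.EllipticCurves.ModularForms.cesnavicius_not_two_dvd_maninConstant_of_two_dvd_level →
      Literature.NumberTheory.EllipticCurves.ModularForms.exists_isNewformOf →
      ∀ (W : WeierstrassCurve ℚ) [W.IsElliptic] [W.IsGloballyMinimal] {N : ℕ} [NeZero N]
        (D : ModularParametrizationData W N),
        (∀ z ∈ D.L.lattice, ∃ w ∈ periodLattice D.f, z = D.c * w) → 3 ^ 2 ∣ N → P W N →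
        ¬ (3 : ℤ) ∣ D.maninConstant) →
      Summit.BirchSwinnertonDyer.BirchSwinnertonDyer.Theses.ManinLocalTwoThree.ManinPrimeToThreeAtNine)
    (hK : kato_neron_isIntegral_twistedSymbolSum_of_additive_three_polar) (hG : ShiftClassGenerationThree)
    (hB : ∀ (W : WeierstrassCurve ℚ) [W.IsElliptic] [W.IsGloballyMinimal] {N : ℕ} [NeZero N]
      (D : ModularParametrizationData W N),
      (∀ z ∈ D.L.lattice, ∃ w ∈ periodLattice D.f, z = D.c * w) → 3 ^ 2 ∣ N →
      P W N → ¬ W.HasIrreducibleModPGaloisRep 3 → ¬ (3 : ℤ) ∣ D.c)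
    : Summit.BirchSwinnertonDyer.BirchSwinnertonDyer.Theses.ManinLocalTwoThree.ManinPrimeToThreeAtNine :=
  maninPrimeToThreeAtNine_of_reduction_of_katoShift P hred (katoShiftTwistManinThree_of_katoFact_of_generation hK hG) hB

end Generic


section Partition

variable (P : WeierstrassCurve ℚ → ℕ → Prop)

/-- **The generic split is LOSSLESS**: granted `PrintedSemistableManinFacts` and any reduction `hred` to a class
predicate `P`, C3 is EQUIVALENT to (shift-twist certificate on the `W[3]`-irreducible data with `P`) ∧ (Manin at `3`
on the `W[3]`-reducible data with `P`) — each conjunct a restriction of the crux.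
[cite: Stevens1989, Lemmas (5.2), (5.4)] [cite: Kato2004Asterisque, Thm. 9.7 (p. 189)] -/
theorem maninPrimeToThreeAtNine_iff_split_of_reduction (hPF : Summit.BirchSwinnertonDyer.BirchSwinnertonDyer.Theses.ManinLocalTwoThree.PrintedSemistableManinFacts)
    (hred : (Literature.NumberTheory.EllipticCurves.ModularForms.mazur_not_dvd_maninConstant_of_odd →
      Literature.NumberTheory.EllipticCurves.ModularForms.abbesUllmo_not_dvd_maninConstant_of_not_dvd_level →
      Literature.NumberTheory.EllipticCurves.ModularForms.cesnavicius_not_two_dvd_maninConstant_of_two_dvd_level →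
      Literature.NumberTheory.EllipticCurves.ModularForms.exists_isNewformOf →
      ∀ (W : WeierstrassCurve ℚ) [W.IsElliptic] [W.IsGloballyMinimal] {N : ℕ} [NeZero N]
        (D : ModularParametrizationData W N),
        (∀ z ∈ D.L.lattice, ∃ w ∈ periodLattice D.f, z = D.c * w) → 3 ^ 2 ∣ N → P W N →
        ¬ (3 : ℤ) ∣ D.maninConstant) →
      Summit.BirchSwinnertonDyer.BirchSwinnertonDyer.Theses.ManinLocalTwoThree.ManinPrimeToThreeAtNine) :
    Summit.BirchSwinnertonDyer.BirchSwinnertonDyer.Theses.ManinLocalTwoThree.ManinPrimeToThreeAtNine ↔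
      ((∀ (W : WeierstrassCurve ℚ) [W.IsElliptic] [W.IsGloballyMinimal] {N : ℕ} [NeZero N]
        (D : ModularParametrizationData W N),
        (∀ z ∈ D.L.lattice, ∃ w ∈ periodLattice D.f, z = D.c * w) → 3 ^ 2 ∣ N → P W N →
          W.HasIrreducibleModPGaloisRep 3 → ¬ (3 : ℤ) ∣ D.c) ∧
        (∀ (W : WeierstrassCurve ℚ) [W.IsElliptic] [W.IsGloballyMinimal] {N : ℕ} [NeZero N]
        (D : ModularParametrizationData W N),
        (∀ z ∈ D.L.lattice, ∃ w ∈ periodLattice D.f, z = D.c * w) → 3 ^ 2 ∣ N → P W N →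
          ¬ W.HasIrreducibleModPGaloisRep 3 → ¬ (3 : ℤ) ∣ D.c)) := by
  obtain ⟨hM, hAU, hC, hnf⟩ := hPF
  refine ⟨fun h3 => ⟨?_, ?_⟩, fun h => maninPrimeToThreeAtNine_of_reduction_of_split P hred h.1 h.2⟩
  · intro W _ _ N _ D hopt h9 _ _
    exact h3 hM hAU hC hnf W D hopt h9
  · intro W _ _ N _ D hopt h9 _ _
    exact h3 hM hAU hC hnf W D hopt h9

end Partition

end Summit.BirchSwinnertonDyer.BirchSwinnertonDyer.Theorems.ManinLocalTwoThree

end
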